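import Summits.BirchSwinnertonDyer.BirchSwinnertonDyer.Theorems.ManinLocalTwoThreePinningKernel
import HarnessLib

/-!
# Pinning kernel, part F: NEWFORM ROWS — from `d′ • f = Σ_j y_j • C_j` to `f = Φ` by one decidable row check

Cell `bsd-f2-manin`, route `ManinLocalTwoThree`, cruxes C2 `ManinOddAtFour` (stmt-BirchSwinnertonDyer-22967) / C3
`ManinPrimeToThreeAtNine` (stmt-BirchSwinnertonDyer-22968), an g55 (LENS analytic/periods); `--supports stmt-BirchSwinnertonDyer-22967`
(helper).  Level-free complement of `…PinningKernel` §1/§3 (the dual certificate `⟨uᵢ, t_j⟩ = d·δᵢⱼ` of a basis `C` of `V` with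
certified coefficient tables `t_j` to depth `K`).

THE USE.  A level file's `pinning` theorem ends in `d′ • F = Σ_j y_j • C_j` (`F` = the newform of an `X₀(N)`-datum read in
`M₂(Γ₀(N))`, `(σ, d′, y)` a surviving certificate).  To IDENTIFY `F` with a NAMED form `Φ ∈ V` (an `η`-quotient newform, a twist
`charTwist … φ` of a lower-level newform, a CM theta series …) whose coefficient table `tΦ` to depth `K` is certified, it suffices to
check the INTEGER ROW IDENTITY `d′ · tΦ[n] = Σ_j y_j · t_j[n]` for `n < K` (decidable): then `d′ • Φ = Σ_j y_j • C_j` by separation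
(`eq_of_dual`), hence `F = Φ` (`d′ ≠ 0`).  This is how the rows «`D.f = φ₁₄₄ₐ`», «`D.f = charTwist 144 … φ₇₂`» (level `144`), and the
twisted rows asked at `112`, `176`, `432`, `128` are discharged from the kernel pinning, with no Sturm bound and no Hecke theory.
* `smul_eq_sum_of_row` : row identity ⇒ `d′ • Φ = Σ_j y_j • C_j`;
* `eq_of_smul_eq_sum_of_row` : … and `d′ • F = Σ_j y_j • C_j`, `d′ ≠ 0` ⇒ `F = Φ`;
* `modCoefₗ_modularForm`, `cuspForm_eq_of_modularForm_eq`, `coe_eq_of_modularForm_eq` : the `M₂`/`S₂` bookkeeping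
  (`aₙ` of a cusp form read in `M₂` is `cuspCoeff`; equality in `M₂` gives equality in `S₂` and of functions).
HONEST FRAMING: linear algebra only; unconditional, standard axioms; nothing here proves C2/C3, Manin's conjecture or BSD.
[cite: DiamondShurman2005, Thm. 3.5.1] [cite: CremonaAlgorithms1997, §2.10]
-/

set_option autoImplicit false
-- lint-debt: the directory name repeats the summit name (sibling precedent `ManinLocalTwoThreePinningKernel.lean`)
set_option linter.dupNamespace false

noncomputable section

open UpperHalfPlane hiding I
open scoped MatrixGroups ModularForm
open ModularForm CongruenceSubgroup PowerSeries
open Literature.NumberTheory.ModularForms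
open Literature.NumberTheory.EllipticCurves Literature.NumberTheory.EllipticCurves.ModularForms

namespace Summit.BirchSwinnertonDyer.BirchSwinnertonDyer.Theorems.ManinLocalTwoThree.PinningKernel

/-! ## §1 The row identity, abstractly -/

section Rows

variable {V : Type*} [AddCommGroup V] [Module ℂ V] [FiniteDimensional ℂ V]
  {g K : ℕ} {coef : ℕ → V →ₗ[ℂ] ℂ} (C : Fin g → V) (t u : Fin g → List ℤ) (d : ℤ)
  (ht : ∀ i, ∀ n < K, (((t i).getD n 0 : ℤ) : ℂ) = coef n (C i)) (hu : ∀ i, (u i).length ≤ K)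
  (hdual : ∀ i j, dotList (u i) (t j) = if i = j then d else 0) (hd : d ≠ 0) (hdim : Module.finrank ℂ V = g)

include ht hu hdual hd hdim in
/-- **ROW IDENTITY ⇒ COORDINATES.**  If `Φ ∈ V` has the certified table `tΦ` to depth `K` and the integers `d′, y` satisfy
`d′ · tΦ[n] = Σ_j y_j · t_j[n]` for all `n < K` (decidable), then `d′ • Φ = Σ_j y_j • C_j`. [cite: DiamondShurman2005, Thm. 3.5.1] -/
theorem smul_eq_sum_of_row (Φ : V) (tΦ : List ℤ) (hΦ : ∀ n < K, ((tΦ.getD n 0 : ℤ) : ℂ) = coef n Φ) (d' : ℤ) (y : List ℤ)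
    (hrow : ∀ n < K, d' * tΦ.getD n 0 = ∑ j : Fin g, y.getD (j : ℕ) 0 * (t j).getD n 0) :
    ((d' : ℤ) : ℂ) • Φ = ∑ j : Fin g, ((y.getD (j : ℕ) 0 : ℤ) : ℂ) • C j := by
  refine eq_of_dual C t u d ht hu hdual hd hdim fun i n hn _ ↦ ?_
  have hnK : n < K := lt_of_lt_of_le hn (hu i)
  rw [map_smul, map_sum, smul_eq_mul, ← hΦ n hnK]
  simp_rw [map_smul, smul_eq_mul]
  rw [Finset.sum_congr rfl fun j _ ↦ by rw [← ht j n hnK]]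
  exact_mod_cast hrow n hnK

include ht hu hdual hd hdim in
/-- **ROW IDENTITY + PINNING ⇒ IDENTIFICATION.**  With `d′ • F = Σ_j y_j • C_j` (the conclusion of a level file's `pinning`)
and `d′ ≠ 0`: `F = Φ`. [cite: DiamondShurman2005, Thm. 3.5.1] -/
theorem eq_of_smul_eq_sum_of_row {F : V} (Φ : V) (tΦ : List ℤ) (hΦ : ∀ n < K, ((tΦ.getD n 0 : ℤ) : ℂ) = coef n Φ)
    (d' : ℤ) (hd' : d' ≠ 0) (y : List ℤ) (hpin : ((d' : ℤ) : ℂ) • F = ∑ j : Fin g, ((y.getD (j : ℕ) 0 : ℤ) : ℂ) • C j)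
    (hrow : ∀ n < K, d' * tΦ.getD n 0 = ∑ j : Fin g, y.getD (j : ℕ) 0 * (t j).getD n 0) : F = Φ :=
  smul_right_injective V (Int.cast_ne_zero.mpr hd')
    (hpin.trans (smul_eq_sum_of_row C t u d ht hu hdual hd hdim Φ tΦ hΦ d' y hrow).symm)

end Rows

/-! ## §2 `S₂ ↪ M₂` bookkeeping -/

section Bookkeeping

variable {N : ℕ} {k : ℤ}

/-- `aₙ` of a cusp form read in `M_k(Γ₀(N))` is `cuspCoeff`. [folklore] -/
theorem modCoefₗ_modularForm (f : CuspForm (Gamma0 N) k) (n : ℕ) :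
    modCoefₗ N k n (ModularFormClass.modularForm f) = cuspCoeff f n := rfl

/-- Equality in `M_k` gives equality of functions. [folklore] -/
theorem coe_eq_of_modularForm_eq {f g : CuspForm (Gamma0 N) k}
    (h : ModularFormClass.modularForm f = ModularFormClass.modularForm g) : (⇑f : ℍ → ℂ) = ⇑g := by
  have h' := congrArg (fun F : ModularForm (Gamma0 N) k ↦ (⇑F : ℍ → ℂ)) h
  exact h'

/-- Equality in `M_k` gives equality in `S_k`. [folklore] -/
theorem cuspForm_eq_of_modularForm_eq {f g : CuspForm (Gamma0 N) k}
    (h : ModularFormClass.modularForm f = ModularFormClass.modularForm g) : f = g :=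
  DFunLike.ext' (coe_eq_of_modularForm_eq h)

/-- Equality in `M_k` with a form of known function gives the function. [folklore] -/
theorem coe_eq_of_modularForm_eq' {f : CuspForm (Gamma0 N) k} {Φ : ModularForm (Gamma0 N) k} {φ : ℍ → ℂ}
    (h : ModularFormClass.modularForm f = Φ) (hΦ : ∀ τ : ℍ, Φ τ = φ τ) : (⇑f : ℍ → ℂ) = φ := by
  funext τ
  rw [← hΦ τ, ← h]
  rfl

end Bookkeeping

end Summit.BirchSwinnertonDyer.BirchSwinnertonDyer.Theorems.ManinLocalTwoThree.PinningKernel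

end
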